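import Mathlib
import HarnessLib
import Literature.Analysis.FluidPDE.SuitableWeak
import Literature.Analysis.FluidPDE.SelfSimilar
import Literature.Analysis.FluidPDE.LocalTypeI
import Literature.Analysis.FluidPDE.SpaceTimeRescaling
import Literature.Analysis.FluidPDE.LocalTypeIScaling
import Literature.Analysis.FluidPDE.LocalTypeICongr
import Literature.Analysis.FluidPDE.LocalTypeIReverseZoom
import Literature.Analysis.FluidPDE.SlabTypeICompactness
import Literature.Analysis.FluidPDE.TypeIRateOseenMildRepresentative
import Summits.NavierStokesRegularity.NavierStokesRegularity.Theorems.RellichScarApexLocalisationSpherePersistence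
import Summits.NavierStokesRegularity.NavierStokesRegularity.Theorems.RellichScarApexLocalisationParentChild

/-!
# Small-rate regularity (line activity-genealogy-fission, crux ApexLocalisation,
# stub `stub_smallRateRegularity`)

ε-REGULARITY IN RATE FORM.  For every `I < ⊤` there is `η > 0` such that a suitable weak solution
`(u, p)` of Navier–Stokes on the backward slab `𝕊 = (-∞, 0) × ℝ³` with weak gradient `G`,
Albritton–Barker quantity `𝐈(u, p, G) ≤ I` and the SMALL Type-I rate `‖u(t, x)‖ ≤ η/√(−t)` a.e.
on the unit backward ball `Q(0, 1) = (-1, 0) × B₁` is NOT backward-singular at the space–time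
origin (`stub_smallRateRegularity`).

Proof by compactness + persistence (Albritton–Barker 2019, Lemma 2.2 + Prop. 2.3 on the slab,
i.e. the tree's ENGINE `slab_typeI_compactness`), with no ε-regularity constant:

1. if no `η` works, pick for `η_k = 1/(k+1)` a violator `(u_k, p_k, G_k)`: class data `𝐈 ≤ I`,
   the rate `η_k/√(−t)` a.e. on `Q(0, 1)`, and a singular origin;
2. the ENGINE extracts `σ` and a limit `(v, q, H)` with `u_{σ j} → v` in `L³(Q(0, R))` for
   every `R > 0`;
3. persistence: every `u_{σ j}` is singular at the origin, so
   `‖u_{σ j}‖_{L^∞(Q(0,R))} = ∞` for all `j` and `R`, and the ENGINE's persistence clause makes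
   the origin a backward singular point of `v`;
4. but along an a.e.-convergent subsequence on `Q(0, 1)` (convergence in measure) the bounds
   `‖u_{σ j}(t, x)‖ ≤ η_{σ j}/√(−t) → 0` force `v = 0` a.e. on `Q(0, 1)`, whence
   `‖v‖_{L^∞(Q(0,1))} = 0 ≠ ∞` — a contradiction.

## References

* D. Albritton, T. Barker, *On local Type I singularities of the Navier–Stokes equations and
  Liouville theorems*, J. Math. Fluid Mech. 21 (2019) = arXiv:1811.00502, Lemma 2.2, Prop. 2.3,
  §3. [AlbrittonBarker2019]
-/

set_option linter.dupNamespace false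

namespace Summit.NavierStokesRegularity.NavierStokesRegularity.Theorems.RellichScarApexLocalisation

open MeasureTheory Set Function Metric Filter Topology TopologicalSpace
open scoped ENNReal NNReal
open Literature.Analysis Literature.Analysis.FluidPDE

/-! ### A tool: vanishing rates force a vanishing `L³`-limit -/

/-- **Vanishing a.e. bounds pass to `L³`-limits.** If `f k → g` in `L³(μ)` and
`‖f k x‖ ≤ c k * B x` for `μ`-a.e. `x` (all `k`) with `c k → 0`, then `g = 0` `μ`-a.e.
(convergence in measure, a.e. convergence along a subsequence, squeeze). -/
theorem ae_eq_zero_of_tendsto_eLpNorm_three_of_vanishing_bounds {α F : Type*} [MeasurableSpace α]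
    [NormedAddCommGroup F] {μ : Measure α} {f : ℕ → α → F} {g : α → F} {c : ℕ → ℝ} {B : α → ℝ}
    (hf : ∀ k, AEStronglyMeasurable (f k) μ) (hg : AEStronglyMeasurable g μ)
    (hB : ∀ k, ∀ᵐ x ∂μ, ‖f k x‖ ≤ c k * B x) (hc : Tendsto c atTop (𝓝 0))
    (h : Tendsto (fun k => eLpNorm (f k - g) 3 μ) atTop (𝓝 0)) :
    ∀ᵐ x ∂μ, g x = 0 := by
  have h3 : (3 : ℝ≥0∞) ≠ 0 := by norm_num
  have hm : TendstoInMeasure μ f atTop g :=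
    tendstoInMeasure_of_tendsto_eLpNorm (p := 3) h3 hf hg h
  obtain ⟨ns, hns, hae⟩ := hm.exists_seq_tendsto_ae
  have hB' : ∀ᵐ x ∂μ, ∀ k, ‖f k x‖ ≤ c k * B x := ae_all_iff.2 hB
  filter_upwards [hae, hB'] with x hx hxB
  have hc' : Tendsto (fun i => c (ns i) * B x) atTop (𝓝 0) := by
    have h1 : Tendsto (fun i => c (ns i)) atTop (𝓝 0) := hc.comp hns.tendsto_atTop
    simpa using h1.mul_const (B x)
  have hlim0 : Tendsto (fun i => f (ns i) x) atTop (𝓝 0) :=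
    squeeze_zero_norm (fun i => hxB (ns i)) hc'
  exact tendsto_nhds_unique hx hlim0

/-! ### The stub -/

/-- **S1a, SMALL-RATE REGULARITY** (ε-regularity in rate form; Albritton–Barker 2019 Lemma 2.2 +
Prop. 2.3 on the slab = the tree's `slab_typeI_compactness`, by contradiction): for every `I < ⊤`
there is `η > 0` such that every suitable weak slab solution `(u, p)` with weak gradient `G`,
`𝐈(u, p, G) ≤ I` and the small rate `‖u(t, x)‖ ≤ η/√(−t)` a.e. on `Q(0, 1)` is not
backward-singular at the origin.  (Violators for `η_k = 1/(k+1) → 0` subconverge in `L³_loc` to a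
slab profile which is singular at the origin by persistence, yet vanishes a.e. on `Q(0, 1)`.)
[cite: AlbrittonBarker2019, Lemma 2.2, Prop. 2.3 and §3] -/
theorem stub_smallRateRegularity :
    ∀ I : ℝ≥0∞, I < ⊤ → ∃ η : ℝ, 0 < η ∧
      ∀ (u : ℝ → (EuclideanSpace ℝ (Fin 3)) → (EuclideanSpace ℝ (Fin 3)))
        (p : ℝ → (EuclideanSpace ℝ (Fin 3)) → ℝ)
        (G : ℝ → (EuclideanSpace ℝ (Fin 3)) →
          (EuclideanSpace ℝ (Fin 3)) →L[ℝ] (EuclideanSpace ℝ (Fin 3))),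
        IsSuitableWeakSolutionOn (slab (EuclideanSpace ℝ (Fin 3)) (Iio 0) isOpen_Iio) 1 0 u p →
        HasWeakSpatialGradientOn (slab (EuclideanSpace ℝ (Fin 3)) (Iio 0) isOpen_Iio) u G →
        typeIBound (Iio (0 : ℝ) ×ˢ univ) u p G ≤ I →
        (∀ᵐ z ∂(volume.restrict (parabolicCylinder 1 (0 : ℝ × (EuclideanSpace ℝ (Fin 3))))),
          ‖u z.1 z.2‖ ≤ η / Real.sqrt (-z.1)) →
        ¬ IsBackwardSingularPoint u 0 := by
  intro I hI
  by_contra h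
  push Not at h
  -- ## Step 1: violators for `η_k = 1/(k+1)`
  have hη : ∀ k : ℕ, (0 : ℝ) < 1 / ((k : ℝ) + 1) := fun k => by positivity
  choose u p G hsw hwg hI' hsmall hsing using fun k : ℕ => h (1 / ((k : ℝ) + 1)) (hη k)
  -- ## Step 2: the ENGINE
  obtain ⟨v, q, H, σ, hσ, -, hvg, -, hconv, hpers⟩ :=
    slab_typeI_compactness I u p G hI hsw hwg hI'
  -- ## Step 3: persistence — every approximant is singular at the origin
  have hvsing : IsBackwardSingularPoint v 0 := by
    refine hpers fun R hR => ?_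
    have hconst : (fun j => eLpNorm (uncurry (u (σ j))) ⊤
        (volume.restrict (parabolicCylinder R (0 : ℝ × (EuclideanSpace ℝ (Fin 3)))))) =
        fun _ => (⊤ : ℝ≥0∞) :=
      funext fun j => hsing (σ j) R hR
    rw [hconst]
    exact limsup_const ⊤
  -- ## Step 4: the limit vanishes a.e. on `Q(0, 1)`
  have hQs : parabolicCylinder 1 (0 : ℝ × (EuclideanSpace ℝ (Fin 3))) ⊆
      Iio (0 : ℝ) ×ˢ (univ : Set (EuclideanSpace ℝ (Fin 3))) :=
    parabolicCylinder_origin_subset_slab 1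
  have hQm : MeasurableSet (parabolicCylinder 1 (0 : ℝ × (EuclideanSpace ℝ (Fin 3)))) :=
    (isOpen_parabolicCylinder _ _).measurableSet
  have hum : ∀ j, AEStronglyMeasurable (uncurry (u (σ j)))
      (volume.restrict (parabolicCylinder 1 (0 : ℝ × (EuclideanSpace ℝ (Fin 3))))) := fun j =>
    ((hwg (σ j)).locallyIntegrableOn.aestronglyMeasurable).mono_measure
      (Measure.restrict_mono hQs le_rfl)
  have hvm : AEStronglyMeasurable (uncurry v)
      (volume.restrict (parabolicCylinder 1 (0 : ℝ × (EuclideanSpace ℝ (Fin 3))))) :=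
    (hvg.locallyIntegrableOn.aestronglyMeasurable).mono_measure (Measure.restrict_mono hQs le_rfl)
  have hbd : ∀ j,
      ∀ᵐ z ∂(volume.restrict (parabolicCylinder 1 (0 : ℝ × (EuclideanSpace ℝ (Fin 3))))),
      ‖uncurry (u (σ j)) z‖ ≤ (1 / (((σ j : ℕ) : ℝ) + 1)) * (1 / Real.sqrt (-z.1)) := fun j => by
    filter_upwards [hsmall (σ j)] with z hz
    rw [mul_one_div]
    exact hz
  have hc : Tendsto (fun j => 1 / (((σ j : ℕ) : ℝ) + 1)) atTop (𝓝 0) :=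
    tendsto_one_div_add_atTop_nhds_zero_nat.comp hσ.tendsto_atTop
  have hv0 : ∀ᵐ z ∂(volume.restrict (parabolicCylinder 1 (0 : ℝ × (EuclideanSpace ℝ (Fin 3))))),
      uncurry v z = 0 :=
    ae_eq_zero_of_tendsto_eLpNorm_three_of_vanishing_bounds hum hvm hbd hc (hconv 1 one_pos)
  -- ## Step 5: contradiction — `‖v‖_{L^∞(Q(0,1))} = 0 ≠ ∞`
  have hv0' :
      uncurry v =ᵐ[volume.restrict (parabolicCylinder 1 (0 : ℝ × (EuclideanSpace ℝ (Fin 3))))]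
      (0 : ℝ × (EuclideanSpace ℝ (Fin 3)) → (EuclideanSpace ℝ (Fin 3))) := hv0
  have hzero : eLpNorm (uncurry v) ⊤
      (volume.restrict (parabolicCylinder 1 (0 : ℝ × (EuclideanSpace ℝ (Fin 3))))) = 0 := by
    rw [eLpNorm_congr_ae hv0', eLpNorm_zero]
  have htop : eLpNorm (uncurry v) ⊤
      (volume.restrict (parabolicCylinder 1 (0 : ℝ × (EuclideanSpace ℝ (Fin 3))))) = ⊤ :=
    hvsing 1 one_pos
  rw [hzero] at htop
  exact ENNReal.zero_ne_top htop

end Summit.NavierStokesRegularity.NavierStokesRegularity.Theorems.RellichScarApexLocalisation
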